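import Summits.ValiantsHypothesis.ValiantsHypothesis.Theorems.SymPencilPerFourSixDimDetecting
import Summits.ValiantsHypothesis.ValiantsHypothesis.Theorems.SymPencilSdcPerFourInnerRankH88

/-!
# Route `SymPencil` — size `25` modulo the single structural residual `R6`
# (`--supports` stmt-ValiantsHypothesis-5674 `SdcSuperquadratic`; rung currency only)

Combining `SymPencilPerFourSixDimDetecting.eq_twentyFive_and_oneRowKernel_of_R6` (val-width-5674-p3:
the `(10, 6)` cell modulo `R6`, on the reduction `SymPencilSdcPerFourTwentySixReduction`) with
val-width-5674-p2 g2's `SymPencilSdcPerFourInnerRankH88.not_joint_eight_squares` (Task T2 / `H88`: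
the `2|2` row split of `per_4` has inner rank `≥ 9`):

**Theorem** (`eq_twentyFive_and_oneRowKernel_of_R6'`).  Assume only `R6`: every `6`-dimensional
`V ⊆ Sing Z(per_4)` satisfying the row and column minors has a detecting pair of rows, or of
columns, or lies in a cross.  Then every symmetric affine determinantal representation of `per_4`
of size `m ≤ 25` (characteristic `0`) has `m = 25`, LAGRANGIAN kernel rows (`2 · dim im bL = 24`)
and a `4`-dimensional kernel inside one row or one column — the cell `(12, 4, 0)` of
`Cruxes/SdcSuperquadratic/NEXT-RUNG-25.md`, which no second-moment reading sees and which is REAL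
one size down (`sdc(per_3) = 13`, val-width-5676-p2 g4).  So «`sdc(per_4) ≥ 26`» ⟺ `R6` ∧ «no
size-`25` symmetric pencil with Lagrangian one-row kernel» (g4's NC1).

Honest framing: conditional on `R6` (the `6`-dimensional twin of g3's `seven_trichotomy` under the
minors; not claimed); the tree's window is `25 ≤ sdc(per₄) ≤ 29`; the crux `SdcSuperquadratic` and
`VP ≠ VNP` are untouched.  No definitions, no named facts. [folklore]
-/

noncomputable section

-- single-conjunct layout: Sub = Summit, duplicated namespace component intended
set_option linter.dupNamespace false

namespace Summit.ValiantsHypothesis.ValiantsHypothesis.Theorems.SymPencilSdcPerFourTwentySixOfR6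

open Matrix MvPolynomial Module
open Literature.Computability.AlgebraicComplexity
open Summit.ValiantsHypothesis.ValiantsHypothesis.Theorems.SymPencilPerFourSixDimDetecting
open Summit.ValiantsHypothesis.ValiantsHypothesis.Theorems.SymPencilSdcPerFourInnerRankH88

/-- **Size `≤ 25` forces size `25` with a Lagrangian one-row (one-column) kernel, given only the
structural residual `R6`.**  See the module docstring. [folklore] -/
theorem eq_twentyFive_and_oneRowKernel_of_R6' (K : Type*) [Field K] [CharZero K]
    (R6 : ∀ W : Submodule K (Fin 4 × Fin 4 → K),
      (∀ x ∈ W, ∀ (r c : Fin 3 → Fin 4), Function.Injective r → Function.Injective c →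
        ((Matrix.of fun i j => x (i, j)).submatrix r c).permanent = 0) →
      finrank K W = 6 →
      (∀ a b m : Fin 4, a ≠ b → ∃ c : Fin 4, c ≠ m ∧
        ∀ y ∈ W, y (a, c) * y (b, m) + y (a, m) * y (b, c) = 0) →
      (∀ a b m : Fin 4, a ≠ b → ∃ c : Fin 4, c ≠ m ∧
        ∀ y ∈ W, y (c, a) * y (m, b) + y (m, a) * y (c, b) = 0) →
      (∃ p q : Fin 4, p ≠ q ∧ ∀ x ∈ W, (∀ j, x (p, j) = 0) → (∀ j, x (q, j) = 0) → x = 0) ∨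
      (∃ p q : Fin 4, p ≠ q ∧ ∀ x ∈ W, (∀ i, x (i, p) = 0) → (∀ i, x (i, q) = 0) → x = 0) ∨
      (∃ l c : Fin 4, ∀ x ∈ W, ∀ i j : Fin 4, i ≠ l → j ≠ c → x (i, j) = 0))
    {m : ℕ} (hm : m ≤ 25) {A : Matrix (Fin m) (Fin m) (MvPolynomial (Fin 4 × Fin 4) K)}
    (hS : A.IsSymm) (hA : IsAffineDetRepr (perPoly (Fin 4) K) A) :
    m = 25 ∧
    ∃ (i₀ : Fin m) (D : Matrix {i // i ≠ i₀} {i // i ≠ i₀} K)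
      (bL : (Fin 4 × Fin 4 → K) →ₗ[K] ({i // i ≠ i₀} → K))
      (CL : (Fin 4 × Fin 4 → K) →ₗ[K] Matrix {i // i ≠ i₀} {i // i ≠ i₀} K) (κ : K),
      IsUnit D.det ∧ Dᵀ = D ∧ (∀ z, (CL z)ᵀ = CL z) ∧ κ ≠ 0 ∧
      (∀ z, bL z ⬝ᵥ D⁻¹ *ᵥ bL z = 0) ∧
      (∀ z, bL z ⬝ᵥ (D⁻¹ * CL z * D⁻¹) *ᵥ bL z = 0) ∧
      (∀ z, D.det * (bL z ⬝ᵥ (D⁻¹ * CL z * D⁻¹ * CL z * D⁻¹) *ᵥ bL z) =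
        -(κ * eval z (perPoly (Fin 4) K))) ∧
      2 * finrank K (LinearMap.range bL) = 24 ∧ finrank K (LinearMap.ker bL) = 4 ∧
      ((∃ l : Fin 4, ∀ x ∈ LinearMap.ker bL, ∀ i j : Fin 4, i ≠ l → x (i, j) = 0) ∨
       (∃ c : Fin 4, ∀ x ∈ LinearMap.ker bL, ∀ i j : Fin 4, j ≠ c → x (i, j) = 0)) :=
  eq_twentyFive_and_oneRowKernel_of_R6 K (not_joint_eight_squares K) R6 hm hS hA

end Summit.ValiantsHypothesis.ValiantsHypothesis.Theorems.SymPencilSdcPerFourTwentySixOfR6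

end
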